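import Literature.MathematicalPhysics.QuantumFieldTheory.U1DualRepresentation
import HarnessLib

/-!
# The closed-flux ensemble: `⟨W_γ⟩_Λ = ∑_{∂c = 0} ∏ₚ I_{cₚ + Sₚ}(β) / ∑_{∂c = 0} ∏ₚ I_{cₚ}(β)`

Third step of the inline proof programme of the named fact
`Literature.MathematicalPhysics.QuantumFieldTheory.FrohlichSpencerU1PerimeterLawD4` (after
`GinibreCharacterExpansion` and `U1DualRepresentation`): in the dual (flux) representation
`⟨W_γ⟩_{Λ,β} = Z_Λ(J_γ)/Z_Λ(0)` of `zdExpect_u1_wilsonLoop_eq_dual`, the source `J_γ` (the loop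
current) is the boundary of the flat sheet `S_γ` tiled by the `R × T` plaquettes of the rectangle
(the lattice Stokes formula `sum_plaqCurrent_rect_eq_loopCurrent`), so that the change of variables
`m = c + S_γ` turns the constrained flux sum `Z_Λ(J_γ)` into a sum over CLOSED integer plaquette
fields `c` on `Λ` of the shifted weights `∏ₚ I_{cₚ + Sₚ}(β)` (`zdU1DualPartition_eq_tsum_shift`,
`zdU1DualPartition_loopCurrent_eq_tsum_closed`), whence `zdExpect_u1_wilsonLoop_eq_closedFlux`:
the free-boundary Wilson-loop expectation is the ratio of the closed-flux sums with and without
the sheet — the dual `ℤ`-valued model "with the loop inserted along a sheet" of Fröhlich–Spencer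
1982 §2.3 ((2.24) ff., Villain weights) and Guth 1980 §II, here for Wilson's action (Bessel
weights, Cirigliano–Paffuti 1999 §1.2). Everything is proved; no named fact is introduced.

* `lineCurrent_eq_sum`, `lineCurrent_succ_right` (closed form of the straight-line current),
  `sum_plaqCurrent_row` and `sum_plaqCurrent_rect_eq_loopCurrent` (**abelian Stokes on `ℤ^d`**:
  `∑_{t<T, s<R} ∂(x + t eⱼ + s eᵢ; i, j) = J_γ`).
* `rectPlaqs x i j R T` (the plaquettes tiling the rectangle), `sum_plaqCurrent_rectPlaqs`,
  `sheet Λ x i j R T` (their indicator as an integer plaquette field on `Λ`) and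
  `sum_sheet_smul_plaqCurrent` (`∑ₚ Sₚ ∂p = J_γ` whenever the rectangle's plaquettes belong to `Λ`).
* `zdU1DualPartition_eq_tsum_shift` (change of variables `m = c + S` in the flux sum),
  `zdU1DualPartition_loopCurrent_eq_tsum_closed`, `zdExpect_u1_wilsonLoop_eq_closedFlux`.

## References

* J. Fröhlich, T. Spencer, Comm. Math. Phys. 83 (1982) 411–454, §2.3. [FrohlichSpencerCMP1982]
* A. H. Guth, Phys. Rev. D 21 (1980) 2291–2307, §II. [Guth1980]
* V. Cirigliano, G. Paffuti, Comm. Math. Phys. 200 (1999) 381–398, §1.2. [CiriglianoPaffuti1999]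
-/

noncomputable section

open MeasureTheory Filter Finset
open scoped BigOperators
open Literature.Probability.LatticeModels Literature.MathematicalPhysics.QuantumLattice

namespace Literature.MathematicalPhysics.QuantumFieldTheory

variable {d : ℕ}

/-! ### Abelian Stokes on `ℤ^d` -/

/-- Closed form of the straight-line current: `∑_{s<n} [y + s e_k, · + e_k]`. [folklore] -/
theorem lineCurrent_eq_sum (k : Fin d) :
    ∀ (n : ℕ) (y : Literature.Probability.LatticeModels.Site d),
      lineCurrent k n y = ∑ s ∈ Finset.range n, Finsupp.single (y + Pi.single k (s : ℤ), k) 1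
  | 0, y => by simp [lineCurrent]
  | n + 1, y => by
    rw [lineCurrent, lineCurrent_eq_sum k n, Finset.sum_range_succ']
    simp only [Nat.cast_zero, Pi.single_zero, add_zero, Nat.cast_succ]
    rw [add_comm]
    congr 1
    refine Finset.sum_congr rfl fun s _ => ?_
    rw [add_assoc, ← Pi.single_add, add_comm (1 : ℤ)]

/-- Appending one bond at the far end of a straight line. [folklore] -/
theorem lineCurrent_succ_right (k : Fin d) (n : ℕ) (y : Literature.Probability.LatticeModels.Site d) :
    lineCurrent k (n + 1) y = lineCurrent k n y + Finsupp.single (y + Pi.single k (n : ℤ), k) 1 := by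
  rw [lineCurrent_eq_sum, lineCurrent_eq_sum, Finset.sum_range_succ]

/-- The row of `R` plaquettes `(x + s eᵢ; i, j)`, `s < R`: its total current is
`line_i(R; x) + [x + R eᵢ, ·+eⱼ] - line_i(R; x + eⱼ) - [x, ·+eⱼ]` (the inner `j`-bonds cancel).
[folklore] -/
theorem sum_plaqCurrent_row (x : Literature.Probability.LatticeModels.Site d) (i j : Fin d) (R : ℕ) :
    ∑ s ∈ Finset.range R, plaqCurrent ((x + Pi.single i (s : ℤ), i, j) : Plaq d) =
      lineCurrent i R x + Finsupp.single (x + Pi.single i (R : ℤ), j) 1 -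
        lineCurrent i R (x + Pi.single j 1) - Finsupp.single (x, j) 1 := by
  induction R with
  | zero => simp [lineCurrent]
  | succ R ih =>
    rw [Finset.sum_range_succ, ih, lineCurrent_succ_right, lineCurrent_succ_right]
    simp only [plaqCurrent]
    have h1 : x + Pi.single i (R : ℤ) + Pi.single i 1 = x + Pi.single i ((R + 1 : ℕ) : ℤ) := by
      rw [add_assoc, ← Pi.single_add]; push_cast; rfl
    have h2 : x + Pi.single i (R : ℤ) + Pi.single j 1 = x + Pi.single j 1 + Pi.single i (R : ℤ) := by
      abel
    rw [h1, h2]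
    abel

/-- **Abelian Stokes on `ℤ^d`**: the currents of the `T × R` plaquettes `(x + t eⱼ + s eᵢ; i, j)`
tiling the rectangle add up to the loop current `J_γ` of its boundary (inner bonds cancel).
[folklore] -/
theorem sum_plaqCurrent_rect_eq_loopCurrent (x : Literature.Probability.LatticeModels.Site d)
    (i j : Fin d) (R T : ℕ) :
    ∑ t ∈ Finset.range T, ∑ s ∈ Finset.range R,
        plaqCurrent ((x + Pi.single j (t : ℤ) + Pi.single i (s : ℤ), i, j) : Plaq d) =
      loopCurrent x i j R T := by
  induction T with
  | zero =>
    simp only [Finset.range_zero, Finset.sum_empty, loopCurrent, lineCurrent, Nat.cast_zero,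
      Pi.single_zero, add_zero]
    abel
  | succ T ih =>
    have hrow := sum_plaqCurrent_row (x + Pi.single j (T : ℤ)) i j R
    rw [Finset.sum_range_succ, ih, hrow]
    simp only [loopCurrent]
    have hs1 := lineCurrent_succ_right j T (x + Pi.single i (R : ℤ))
    rw [hs1, lineCurrent_succ_right j T x]
    have h1 : x + Pi.single j (T : ℤ) + Pi.single j 1 = x + Pi.single j ((T + 1 : ℕ) : ℤ) := by
      rw [add_assoc, ← Pi.single_add]; push_cast; rfl
    have h2 : x + Pi.single j (T : ℤ) + Pi.single i (R : ℤ) =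
        x + Pi.single i (R : ℤ) + Pi.single j (T : ℤ) := by
      abel
    rw [h1, h2]
    abel

/-! ### The sheet of a rectangular loop -/

/-- The plaquettes `(x + t eⱼ + s eᵢ; i, j)`, `t < T`, `s < R`, tiling the `R × T` rectangle based
at `x` in the `(i, j)` plane (the flat sheet `S_γ` bounded by the loop `γ`). [folklore] -/
def rectPlaqs (x : Literature.Probability.LatticeModels.Site d) (i j : Fin d) (R T : ℕ) :
    Finset (Plaq d) :=
  (Finset.range T ×ˢ Finset.range R).image
    fun ts => (x + Pi.single j (ts.1 : ℤ) + Pi.single i (ts.2 : ℤ), i, j)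

/-- The tiling map is injective (`i ≠ j`: read off the `j`- and `i`-coordinates). [folklore] -/
theorem rectPlaqs_map_injective (x : Literature.Probability.LatticeModels.Site d) {i j : Fin d}
    (hij : i ≠ j) :
    Function.Injective fun ts : ℕ × ℕ =>
      ((x + Pi.single j (ts.1 : ℤ) + Pi.single i (ts.2 : ℤ), i, j) : Plaq d) := by
  intro ts ts' h
  simp only [Prod.mk.injEq, and_true] at h
  have hj := congrFun h j
  have hi := congrFun h i
  simp only [Pi.add_apply, Pi.single_apply, if_true, if_neg (Ne.symm hij), if_neg hij] at hj hi
  ext <;> omega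

/-- The currents of the sheet's plaquettes add up to the loop current. [folklore] -/
theorem sum_plaqCurrent_rectPlaqs (x : Literature.Probability.LatticeModels.Site d) {i j : Fin d}
    (hij : i ≠ j) (R T : ℕ) :
    ∑ p ∈ rectPlaqs x i j R T, plaqCurrent p = loopCurrent x i j R T := by
  rw [rectPlaqs, Finset.sum_image fun ts _ ts' _ h => rectPlaqs_map_injective x hij h,
    Finset.sum_product]
  exact sum_plaqCurrent_rect_eq_loopCurrent x i j R T

/-- **The sheet** `S_γ` as an integer plaquette field on `Λ`: `1` on the plaquettes tiling the
rectangle, `0` elsewhere. [folklore] -/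
def sheet (Λ : Finset (Literature.Probability.LatticeModels.Site d))
    (x : Literature.Probability.LatticeModels.Site d) (i j : Fin d) (R T : ℕ)
    (p : ↥(plaquettesIn Λ)) : ℤ :=
  if (p : Plaq d) ∈ rectPlaqs x i j R T then 1 else 0

/-- `∂S_γ = J_γ`: if the rectangle's plaquettes belong to `Λ`, the boundary of the sheet is the
loop current (Stokes). [folklore] -/
theorem sum_sheet_smul_plaqCurrent {Λ : Finset (Literature.Probability.LatticeModels.Site d)}
    {x : Literature.Probability.LatticeModels.Site d} {i j : Fin d} (hij : i ≠ j) {R T : ℕ}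
    (hsub : rectPlaqs x i j R T ⊆ plaquettesIn Λ) :
    ∑ p, sheet Λ x i j R T p • plaqCurrent (p : Plaq d) = loopCurrent x i j R T := by
  unfold sheet
  rw [Finset.sum_coe_sort (plaquettesIn Λ) (fun p : Plaq d =>
    (if p ∈ rectPlaqs x i j R T then (1 : ℤ) else 0) • plaqCurrent p)]
  simp only [ite_smul, one_smul, zero_smul, Finset.sum_ite_mem]
  rw [Finset.inter_eq_right.2 hsub]
  exact sum_plaqCurrent_rectPlaqs x hij R T

/-! ### The change of variables `m = c + S` in the flux sums -/

open Classical in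
/-- **Shifting the flux sum by a fixed plaquette field `S`**:
`Z_Λ(J) = ∑_{c ∈ ℤ^{P(Λ)}, ∑ₚ cₚ ∂p = J - ∑ₚ Sₚ ∂p} ∏ₚ I_{cₚ + Sₚ}(β)`. [folklore] -/
theorem zdU1DualPartition_eq_tsum_shift (β : ℝ)
    (Λ : Finset (Literature.Probability.LatticeModels.Site d)) (J : ZdEdge d →₀ ℤ)
    (S : ↥(plaquettesIn Λ) → ℤ) :
    zdU1DualPartition β Λ J =
      ∑' c : ↥(plaquettesIn Λ) → ℤ,
        if ∑ p, c p • plaqCurrent (p : Plaq d) = J - ∑ p, S p • plaqCurrent (p : Plaq d) then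
          ∏ p, besselI (c p + S p) β else 0 := by
  unfold zdU1DualPartition
  rw [← (Equiv.addRight S).tsum_eq]
  refine tsum_congr fun c => ?_
  have hsum : ∑ p, (Equiv.addRight S c) p • plaqCurrent (p : Plaq d) =
      ∑ p, c p • plaqCurrent (p : Plaq d) + ∑ p, S p • plaqCurrent (p : Plaq d) := by
    simp only [Equiv.coe_addRight, Pi.add_apply, add_smul, Finset.sum_add_distrib]
  have hiff : ∑ p, (Equiv.addRight S c) p • plaqCurrent (p : Plaq d) = J ↔
      ∑ p, c p • plaqCurrent (p : Plaq d) = J - ∑ p, S p • plaqCurrent (p : Plaq d) := by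
    rw [hsum, eq_sub_iff_add_eq]
  have hprod : ∏ p, besselI ((Equiv.addRight S c) p) β = ∏ p, besselI (c p + S p) β := by
    simp only [Equiv.coe_addRight, Pi.add_apply]
  rw [hprod]
  exact if_congr hiff rfl rfl

open Classical in
/-- **The flux sum with the loop source is a closed-flux sum with the sheet inserted**:
`Z_Λ(J_γ) = ∑_{c : ∑ₚ cₚ ∂p = 0} ∏ₚ I_{cₚ + Sₚ}(β)` when the rectangle's plaquettes belong to
`Λ`. [cite: FrohlichSpencerCMP1982, §2.3 (the dual model with the loop inserted along a sheet); CiriglianoPaffuti1999 §1.2] -/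
theorem zdU1DualPartition_loopCurrent_eq_tsum_closed (β : ℝ)
    {Λ : Finset (Literature.Probability.LatticeModels.Site d)}
    {x : Literature.Probability.LatticeModels.Site d} {i j : Fin d} (hij : i ≠ j) {R T : ℕ}
    (hsub : rectPlaqs x i j R T ⊆ plaquettesIn Λ) :
    zdU1DualPartition β Λ (loopCurrent x i j R T) =
      ∑' c : ↥(plaquettesIn Λ) → ℤ,
        if ∑ p, c p • plaqCurrent (p : Plaq d) = 0 then
          ∏ p, besselI (c p + sheet Λ x i j R T p) β else 0 := by
  rw [zdU1DualPartition_eq_tsum_shift β Λ _ (sheet Λ x i j R T), sum_sheet_smul_plaqCurrent hij hsub,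
    sub_self]

open Classical in
/-- **The free-boundary `U(1)` Wilson-loop expectation as a closed-flux-ensemble ratio**: for a
rectangular loop whose sheet lies in `Λ` (`i ≠ j`),
`⟨W_γ⟩_{Λ,β} = (∑_{∂c = 0} ∏ₚ I_{cₚ + Sₚ}(β)) / (∑_{∂c = 0} ∏ₚ I_{cₚ}(β))`, sums over the closed
integer plaquette fields `c` on `Λ`, `S = S_γ` the sheet of the loop.
[cite: FrohlichSpencerCMP1982, §2.3 (the dual model with the loop inserted along a sheet); CiriglianoPaffuti1999 §1.2] -/
theorem zdExpect_u1_wilsonLoop_eq_closedFlux (β : ℝ)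
    {Λ : Finset (Literature.Probability.LatticeModels.Site d)}
    {x : Literature.Probability.LatticeModels.Site d} {i j : Fin d} (hij : i ≠ j) {R T : ℕ}
    (hsub : rectPlaqs x i j R T ⊆ plaquettesIn Λ) :
    zdExpect u1Rep β Λ (zdWilsonLoop u1Rep x i j R T) =
      (∑' c : ↥(plaquettesIn Λ) → ℤ,
          if ∑ p, c p • plaqCurrent (p : Plaq d) = 0 then
            ∏ p, besselI (c p + sheet Λ x i j R T p) β else 0) /
        ∑' c : ↥(plaquettesIn Λ) → ℤ,
          if ∑ p, c p • plaqCurrent (p : Plaq d) = 0 then ∏ p, besselI (c p) β else 0 := by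
  rw [zdExpect_u1_wilsonLoop_eq_dual, zdU1DualPartition_loopCurrent_eq_tsum_closed β hij hsub]
  rfl

end Literature.MathematicalPhysics.QuantumFieldTheory
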